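import Literature.Computability.AlgebraicComplexity.PowerSumProductObstructions
import Literature.Barriers.ValiantsHypothesis.NotViaSaturationsProofs
import Literature.Computability.AlgebraicComplexity.OrbitMultiplicitySemigroup
import Literature.Computability.AlgebraicComplexity.HwvEvaluationRankBound
import Literature.Computability.AlgebraicComplexity.OrbitClosureProofs
import HarnessLib

/-!
# Discharge of `IK2020_prop_5_3_2` (Ikenmeyer–Kandasamy 2020, Prop. 5.3, second bullet):
# under Alon–Tarsi, `ν = (4m, 2m, …, 2m)` occurs in `ℂ[\overline{GL_m · x_1⋯x_m}]`

Topic `Literature/Computability/AlgebraicComplexity`; proves the named fact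
`Literature.Computability.AlgebraicComplexity.IK2020_prop_5_3_2` of
`PowerSumProductObstructions.lean` (`IK2020_prop_5_3_2_holds`), following the printed proof
(C. Ikenmeyer, U. Kandasamy, *Implementing geometric complexity theory: on the separation of orbit
closures via symmetries*, STOC 2020 = arXiv:1911.03990, Prop. 5.3, proof of the second bullet,
p. 11 of the e-print, verbatim): "Kumar proved [Kum:15] that `mult_{(m)^*} ℂ[\overline{G(x_1⋯x_m)}] ≥ 1`
and that `mult_{(m × m)^*} ℂ[\overline{G(x_1⋯x_m)}] ≥ 1`, provided that `m` satisfies the Alon-Tarsi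
condition. Since `ν = (m × m) + (m × m) + (m) + (m)`, the semigroup property for occurrences in
`ℂ[\overline{G(x_1⋯x_m)}]` (see e.g. [DIP:19]) yields that `mult_{ν^*} ℂ[\overline{G(x_1⋯x_m)}] ≥ 1`."

IK's "Alon-Tarsi condition" (§5, p. 10: "The sign of a Latin square is defined as the product of all
column signs … If the number of even `m × m` Latin squares differs from the number of odd `m × m`
Latin squares, then we say that `m` satisfies the Alon-Tarsi condition") is the COLUMN-signed count,
the tree's `latinColCount m ≠ 0` (`KumarLatinRectangles.lean`); the fact is stated with the tree's
`AlonTarsiConjecture m` (row and column signs, `NotViaSaturations.lean`), and the two agree by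
Huang–Rota (`latinColCount_ne_zero_iff`, `NotViaSaturationsProofs.lean`).

## The steps

1. **Kumar's theorem for the Chow variety** (`IK2020.hasHighestWeight_chowOrbitRep_rectWeight`):
   if `♯CELS(m) ≠ ♯COLS(m)` then for every `i ≤ m` the rectangle `i × m = m δ_i` occurs in
   `ℂ[Chow_m]`, `Chow_m = \overline{GL_m · x_0⋯x_{m-1}}` (tree: `orbitCoordRep (chowMonomial ℂ m) m`).
   This is the argument of the tree's `hasHighestWeight_detOrbitRep_rectWeight` (Kumar, Thm. 6.1,
   there for `Ω_m = \overline{GL_{m²} · det_m} ⊇ Chow_m`) run inside `Sym^m ℂ^m`: the highest-weight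
   vector `P_i` (the tree's hyperdeterminant polynomial `hyperdetPoly m t` on the top `i` variables
   `t`, weight `rectWeight m t = (m δ_i)^*`, `hyperdetPoly_mem_highestWeightSpace`) takes at Kumar's
   point `θ(A) = ∏_r ∑_a c_{r,a} x_{t a}` the value `(m!)^{-i} · designPoly(c)`
   (`hyperdet_arrOf_linProd`), nonzero for some complex `c` because the design polynomial is a
   nonzero integer polynomial (`designPoly_ne_zero_of_latinColCount_ne_zero`, Kumar Lemma 4.2 and
   Prop. 5.2 / Thm. 5.6); and `θ(A)`, a product of `m` linear forms, is the linear substitution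
   `x_r ↦ L_r` applied to `x_0⋯x_{m-1}`, hence a point of `End · (x_0⋯x_{m-1}) ⊆ Chow_m`
   (`IK2020.linProd_mem_orbitClosure_chowMonomial`, via `endOrbit_subset_orbitClosure_holds`;
   Kumar: "Clearly, `Im θ̂ ⊂ 𝒳`", BHI Lemma 2: `Chow_n` is the orbit closure of `w_n`).
2. **Bookkeeping of weights**: `(m δ_i)^* = rectWeight m t` (`IK2020.dual_rectW`), so
   `m δ_i ∈ S(Chow_m) = chowOccWeights m` (`IK2020.rectW_mem_chowOccWeights`); and IK's
   `ν = (4m, 2m, …, 2m) ⊢ 2m(m+1)` (`ikPartition m`) is, as a weight of `GL_m`,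
   `2 · (m δ_1 + m δ_m)` (`IK2020.ofPartition_ikPartition`).
3. **Semigroup property** (`chowOccWeights m` is an additive monoid, BHI (1) / IK "[DIP:19]") and
   occurrence = positivity of the multiplicity (`orbitMultiplicity_pos_iff_hasHighestWeight`).

Corollaries: the pure-multiplicity-obstruction statement of `PowerSumProductObstructions.lean` with
the hypothesis `IK2020_prop_5_3_2` removed (`ik2020_isPureMultiplicityObstructionAt_of_alonTarsi`), and
the reduction of the "in particular `m = τ ± 1`" clause `IK2020_prop_5_3_2_primes` to the two
Alon–Tarsi facts of `NotViaSaturationsAlonTarsi.lean` (Drisko 1997 for `τ + 1`, Glynn 2010 for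
`τ - 1`; `IK2020_prop_5_3_2_primes_of_alonTarsi`). No definitions, no named facts.

## References

* [IkenmeyerKandasamy2019] C. Ikenmeyer, U. Kandasamy, STOC 2020 = arXiv:1911.03990, §5: the
  Alon–Tarsi condition (p. 10), Prop. 5.3 and its proof (pp. 10–11), Thm. 4.3 (`ν`).
* [Kumar2015] S. Kumar, Compositio Math. 151 (2015) 292–312 = arXiv:1109.5996: §3 (`θ`), Lemma 4.2,
  Conj. 4.3, Prop. 5.2, Thm. 5.6, Thm. 6.1 (proof: "`Im θ̂ ⊂ 𝒳`", `P_i|_{Im θ̂} ≠ 0`).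
* [BurgisserHuttenhainIkenmeyer2017] P. Bürgisser, J. Hüttenhain, C. Ikenmeyer, Proc. AMS 145 (2017),
  §1 (1) (`S(Z)` is a monoid), §3 Lemma 2 (`Chow_n = \overline{GL_n · w_n}`).
* [HuangRota1994] R. Huang, G.-C. Rota, Discrete Math. 128 (1994) 225–236 (Alon–Tarsi ⇔ column
  Latin square conjecture; tree: `latinColCount_ne_zero_iff`).
-/

noncomputable section

open MvPolynomial

namespace Literature.Computability.AlgebraicComplexity

open _root_.Literature.NumberTheory.DiophantineGeometry
open _root_.Literature.Barriers.ValiantsHypothesis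
open _root_.Literature.Computability.Complexity
open Kumar2015

namespace IK2020

variable {m i : ℕ}

/-! ### The top `i` variables of `Fin m`

The letters of Kumar's subspace `E_i` are placed at the top `i` indices `m - i + a`, `a < i`, of
`Fin m` (the tree's dual-weight convention: a partition weight `χ` occurs through its dual
`χ^*(r) = -χ(m-1-r)`); they are enumerated by `a ↦ Fin.cast _ (Fin.natAdd (m - i) a)`. -/

/-- The enumeration of the top `i` indices is strictly increasing. [folklore] -/
private theorem top_strictMono (him : i ≤ m) :
    StrictMono fun a : Fin i => Fin.cast (Nat.sub_add_cancel him) (Fin.natAdd (m - i) a) := by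
  intro a b hab
  rw [Fin.lt_def]
  simp only [Fin.val_cast, Fin.val_natAdd]
  exact Nat.add_lt_add_left hab _

/-- The top `i` indices form an upper set. [folklore] -/
private theorem top_upper (him : i ≤ m) (a : Fin i) (x : Fin m)
    (hx : Fin.cast (Nat.sub_add_cancel him) (Fin.natAdd (m - i) a) ≤ x) :
    ∃ b : Fin i, Fin.cast (Nat.sub_add_cancel him) (Fin.natAdd (m - i) b) = x := by
  rw [Fin.le_def] at hx
  simp only [Fin.val_cast, Fin.val_natAdd] at hx
  refine ⟨⟨(x : ℕ) - (m - i), by omega⟩, Fin.ext ?_⟩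
  simp only [Fin.val_cast, Fin.val_natAdd]
  omega

/-- An index is one of the top `i` indices iff it is at least `m - i`. [folklore] -/
private theorem mem_range_top_iff (him : i ≤ m) (x : Fin m) :
    x ∈ Set.range (fun a : Fin i => Fin.cast (Nat.sub_add_cancel him) (Fin.natAdd (m - i) a)) ↔
      m - i ≤ (x : ℕ) := by
  constructor
  · rintro ⟨a, rfl⟩
    simp only [Fin.val_cast, Fin.val_natAdd]
    omega
  · intro hx
    refine ⟨⟨(x : ℕ) - (m - i), by omega⟩, Fin.ext ?_⟩
    simp only [Fin.val_cast, Fin.val_natAdd]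
    omega

/-! ### Products of linear forms lie in the Chow variety -/

/-- **`θ(A) ∈ Chow_m`**: a product of `m` linear forms in the variables `Fin m` is the linear
substitution `x_r ↦ L_r` applied to `x_0 ⋯ x_{m-1}`, hence lies in
`End · (x_0⋯x_{m-1}) ⊆ \overline{GL_m · x_0⋯x_{m-1}} = Chow_m` (Kumar: "Clearly, `Im θ̂ ⊂ 𝒳`",
here for the Chow variety; BHI Lemma 2). [cite: Kumar2015, Thm. 6.1 (proof)] -/
theorem linProd_mem_orbitClosure_chowMonomial (c : Fin m × Fin i → ℂ) (t : Fin i → Fin m) :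
    linProd c t ∈ orbitClosure (chowMonomial ℂ m) := by
  classical
  -- the substitution matrix: column `r` holds the coefficients of `L_r`
  set A : Matrix (Fin m) (Fin m) ℂ :=
    fun j r => ∑ a ∈ Finset.univ.filter (fun a => t a = j), c (r, a) with hA
  have hsub : linSubst (Fin m) ℂ A (chowMonomial ℂ m) = linProd c t := by
    rw [chowMonomial, map_prod]
    unfold linProd
    refine Finset.prod_congr rfl fun r _ => ?_
    rw [linSubst_X]
    simp only [hA, Finset.sum_smul]
    symm
    rw [← Finset.sum_fiberwise_of_maps_to (s := Finset.univ) (t := Finset.univ) (g := t)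
      (fun a _ => Finset.mem_univ (t a))]
    refine Finset.sum_congr rfl fun x _ => Finset.sum_congr rfl fun a ha => ?_
    rw [(Finset.mem_filter.mp ha).2]
  rw [← hsub]
  exact endOrbit_subset_orbitClosure_holds _ ⟨A, rfl⟩

/-- `x_0 ⋯ x_{m-1} ≠ 0`. [folklore] -/
private theorem chowMonomial_ne_zero (m : ℕ) : chowMonomial ℂ m ≠ 0 := by
  rw [chowMonomial]
  exact Finset.prod_ne_zero_iff.mpr fun i _ => X_ne_zero i

/-! ### Kumar's theorem for the Chow variety: the rectangles `m δ_i` occur -/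

/-- **Kumar's occurrences in `ℂ[Chow_m]` (Thm. 5.6 with the evaluation of Thm. 6.1's proof),
unconditional form.** If `♯CELS(m) ≠ ♯COLS(m)`, then for every `i ≤ m` the dual rectangle weight
`rectWeight m t` (`-m` on the top `i` variables `t`, the dual of `m δ_i`) occurs in the coordinate
ring of `Chow_m = \overline{GL_m · x_0⋯x_{m-1}}`: the highest-weight vector `P_i` (the tree's
hyperdeterminant polynomial on the letters `t`) takes at `θ(A) = ∏_r ∑_a c_{r,a} x_{t a} ∈ Chow_m`
the value `(m!)^{-i} · designPoly(c)`, nonzero for a suitable complex `c` since the design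
polynomial is a nonzero integer polynomial. Same argument as the tree's
`hasHighestWeight_detOrbitRep_rectWeight` (there for `Ω_m ⊇ Chow_m`).
[cite: Kumar2015, Thm. 5.6 and Thm. 6.1 (proof)] -/
theorem hasHighestWeight_chowOrbitRep_rectWeight (m i : ℕ) (him : i ≤ m)
    (hm : latinColCount m ≠ 0) :
    HasHighestWeight (orbitCoordRep (chowMonomial ℂ m) m)
      (rectWeight m fun a : Fin i => Fin.cast (Nat.sub_add_cancel him) (Fin.natAdd (m - i) a)) := by
  classical
  have hF := hyperdetPoly_mem_highestWeightSpace (k := ℂ) (ℓ := m) (top_strictMono him)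
    (top_upper him)
  refine hasHighestWeight_orbitCoordRep_of_not_mem _ m hF ?_
  -- a Chow point where the hyperdeterminant does not vanish
  have hP : designPoly i m ≠ 0 := designPoly_ne_zero_of_latinColCount_ne_zero hm him
  obtain ⟨c, hc⟩ : ∃ c : Fin m × Fin i → ℂ, aeval c (designPoly i m) ≠ 0 := by
    by_contra hcon
    push Not at hcon
    apply hP
    apply MvPolynomial.map_injective (Int.castRingHom ℂ) Int.cast_injective
    rw [map_zero]
    apply MvPolynomial.funext
    intro c
    rw [eval_map, map_zero]
    have := hcon c
    rwa [aeval_def, algebraMap_int_eq] at this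
  have hval : aeval (formCoeff m (linProd c fun a : Fin i =>
      Fin.cast (Nat.sub_add_cancel him) (Fin.natAdd (m - i) a)))
      (hyperdetPoly m (fun a : Fin i => Fin.cast (Nat.sub_add_cancel him) (Fin.natAdd (m - i) a)) :
        MvPolynomial (DegIdx (Fin m) m) ℂ) ≠ 0 := by
    rw [aeval_formCoeff_hyperdetPoly, hyperdet_arrOf_linProd c (top_strictMono him).injective]
    exact mul_ne_zero (pow_ne_zero _ (inv_ne_zero (Nat.cast_ne_zero.mpr
      (Nat.factorial_ne_zero m)))) hc
  intro hI
  exact hval (aeval_formCoeff_eq_zero_of_mem_orbitClosure (chowMonomial_isHomogeneous ℂ m)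
    (chowMonomial_ne_zero m) (linProd_mem_orbitClosure_chowMonomial c _) hI)

/-! ### The rectangle weights as elements of `S(Chow_m)` -/

/-- The dual of the rectangle weight `m δ_i = (m, …, m, 0, …, 0)` (`i` entries `m`) of `GL_m` is
`-m` on the top `i` indices, i.e. the tree's `rectWeight m t`. [folklore] -/
private theorem dual_rectW (him : i ≤ m) :
    Weight.dual (fun r : Fin m => if (r : ℕ) < i then (m : ℤ) else 0) =
      rectWeight m fun a : Fin i => Fin.cast (Nat.sub_add_cancel him) (Fin.natAdd (m - i) a) := by
  funext x
  rw [Weight.dual, rectWeight]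
  by_cases hx : m - i ≤ (x : ℕ)
  · rw [if_pos ((mem_range_top_iff him x).mpr hx), if_pos]
    rw [Fin.val_rev]; omega
  · rw [if_neg (fun h => hx ((mem_range_top_iff him x).mp h)), if_neg, neg_zero]
    rw [Fin.val_rev]; omega

/-- **`m δ_i ∈ S(Chow_m)` for `i ≤ m` when `♯CELS(m) ≠ ♯COLS(m)`** (Kumar's occurrences in the
monoid vocabulary of `NotViaSaturationsChow.lean`; IK: "Kumar proved [Kum:15] that
`mult_{(m)^*} ℂ[\overline{G(x_1⋯x_m)}] ≥ 1` and that `mult_{(m × m)^*} ℂ[\overline{G(x_1⋯x_m)}] ≥ 1`,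
provided that `m` satisfies the Alon-Tarsi condition" — the cases `i = 1`, `i = m`).
[cite: Kumar2015, Thm. 5.6] [cite: IkenmeyerKandasamy2019, Prop. 5.3 (proof)] -/
theorem rectW_mem_chowOccWeights (him : i ≤ m) (hm : latinColCount m ≠ 0) :
    (fun r : Fin m => if (r : ℕ) < i then (m : ℤ) else 0) ∈ chowOccWeights m := by
  rw [mem_chowOccWeights_iff, dual_rectW him]
  exact hasHighestWeight_chowOrbitRep_rectWeight m i him hm

/-! ### IK's partition `ν = (4m, 2m, …, 2m) = 2 · ((m) + (m × m))` -/

/-- The sorted parts of `ν = (4m, 2m, …, 2m)` (`m ≥ 1` parts).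
[cite: IkenmeyerKandasamy2019, Thm. 4.3] -/
theorem sortedParts_ikPartition (hm : 1 ≤ m) :
    (ikPartition m).sortedParts = (4 * m) :: List.replicate (m - 1) (2 * m) := by
  change (ikPartition m).parts.sort (· ≥ ·) = _
  have hparts : (ikPartition m).parts = ↑((4 * m) :: List.replicate (m - 1) (2 * m)) := by
    change Multiset.filter (· ≠ 0) ({4 * m} + Multiset.replicate (m - 1) (2 * m)) = _
    rw [Multiset.filter_eq_self.mpr, Multiset.singleton_add, ← Multiset.coe_replicate,
      Multiset.cons_coe]
    intro a ha
    simp only [Multiset.mem_add, Multiset.mem_singleton, Multiset.mem_replicate] at ha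
    omega
  rw [hparts, Multiset.coe_sort]
  apply List.mergeSort_eq_self
  rw [List.pairwise_cons]
  refine ⟨fun b hb => ?_, List.pairwise_replicate.mpr (Or.inr le_rfl)⟩
  rw [List.mem_replicate] at hb
  omega

/-- As a weight of `GL_m`, `ν = (4m, 2m, …, 2m) = 2 · (m δ_1 + m δ_m)` (IK: "Since
`ν = (m × m) + (m × m) + (m) + (m)`"). [cite: IkenmeyerKandasamy2019, Prop. 5.3 (proof)] -/
theorem ofPartition_ikPartition (hm : 1 ≤ m) :
    Weight.ofPartition m (ikPartition m) =
      2 • ((fun r : Fin m => if (r : ℕ) < 1 then (m : ℤ) else 0) +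
        fun r : Fin m => if (r : ℕ) < m then (m : ℤ) else 0) := by
  funext r
  rw [Weight.ofPartition_apply, sortedParts_ikPartition hm]
  simp only [Pi.smul_apply, Pi.add_apply, if_pos r.isLt]
  obtain ⟨r, hr⟩ := r
  cases r with
  | zero =>
    simp only [List.getD_cons_zero, Nat.zero_lt_one, if_true]
    push_cast
    ring
  | succ r' =>
    rw [List.getD_cons_succ, List.getD_eq_getElem _ _ (by rw [List.length_replicate]; omega),
      List.getElem_replicate]
    split_ifs with hlt
    · exact absurd hlt (by simp)
    · push_cast
      ring

end IK2020

/-- **Discharge of `IK2020_prop_5_3_2`** (Ikenmeyer–Kandasamy 2020, Prop. 5.3, second bullet):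
for even `m ≥ 4` satisfying the Alon–Tarsi condition, `mult_{ν^*} ℂ[\overline{G · x_1⋯x_m}] > 0`
for `ν = (4m, 2m, …, 2m)`. Printed proof, followed here: Alon–Tarsi gives `♯CELS(m) ≠ ♯COLS(m)`
(Huang–Rota, `latinColCount_ne_zero_iff`; IK's own "Alon-Tarsi condition" is this column-signed
count), whence Kumar's occurrences of `(m) = m δ_1` and `(m × m) = m δ_m` in `ℂ[Chow_m]`
(`IK2020.rectW_mem_chowOccWeights`), and `ν = 2((m) + (m × m))` occurs by the semigroup property
(`chowOccWeights m` is a monoid); occurrence is positivity of the multiplicity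
(`orbitMultiplicity_pos_iff_hasHighestWeight`). Of the standing hypotheses `4 ≤ m`, `Even m` only
`m ≠ 0` is used. [cite: IkenmeyerKandasamy2019, Prop. 5.3] [cite: Kumar2015, Thm. 5.6] -/
theorem IK2020_prop_5_3_2_holds : IK2020_prop_5_3_2 := by
  intro m h4 _ hAT
  have hm0 : m ≠ 0 := by omega
  have hlc : latinColCount m ≠ 0 := (latinColCount_ne_zero_iff m).mpr hAT
  rw [orbitMultiplicity_pos_iff_hasHighestWeight _ hm0]
  change Weight.ofPartition m (ikPartition m) ∈ chowOccWeights m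
  rw [IK2020.ofPartition_ikPartition (by omega)]
  exact nsmul_mem (add_mem (IK2020.rectW_mem_chowOccWeights (by omega) hlc)
    (IK2020.rectW_mem_chowOccWeights le_rfl hlc)) 2

/-- **IK's pure multiplicity obstruction, now conditional on Alon–Tarsi alone**: for even `m ≥ 4`
satisfying the Alon–Tarsi condition, `ν` is a PURE multiplicity obstruction against
`x_1^m + ⋯ + x_m^m ∈ Δ_m[x_1⋯x_m]` given the facts `IK2020_thm_4_3` and `IK2020_prop_5_3_1` — the
hypothesis `IK2020_prop_5_3_2` of `ik2020_isPureMultiplicityObstructionAt` is discharged.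
[cite: IkenmeyerKandasamy2019, Prop. 5.3] -/
theorem ik2020_isPureMultiplicityObstructionAt_of_alonTarsi (h43 : IK2020_thm_4_3)
    (h1 : IK2020_prop_5_3_1) {m : ℕ} (h4 : 4 ≤ m) (he : Even m) (hAT : AlonTarsiConjecture m) :
    IsPureMultiplicityObstructionAt (chowMonomial ℂ m) (psum (Fin m) ℂ m) m
      (Weight.dualOfPartition m (ikPartition m)) :=
  ik2020_isPureMultiplicityObstructionAt h43 h1 IK2020_prop_5_3_2_holds h4 he hAT

/-- **The "in particular `m = τ ± 1`" clause reduced to the Alon–Tarsi theorems of Drisko and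
Glynn** (IK §5, p. 10: "This is proved for all `m = τ+1` [Dri:97] for an odd prime number `τ` and
for all `m = τ-1` [Gly:10]"): the named fact `IK2020_prop_5_3_2_primes` follows from the two named
facts `Drisko1997_AlonTarsi` and `Glynn2010_AlonTarsi` of `NotViaSaturationsAlonTarsi.lean`.
[cite: IkenmeyerKandasamy2019, Prop. 5.3] [cite: Drisko1997, Thm. 9] [cite: Glynn2010AlonTarsi, Thm. 3.2] -/
theorem IK2020_prop_5_3_2_primes_of_alonTarsi (hD : Drisko1997_AlonTarsi)
    (hG : Glynn2010_AlonTarsi) : IK2020_prop_5_3_2_primes := by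
  intro m τ h4 hτ hodd hm
  have hAT : AlonTarsiConjecture m := by
    rcases hm with rfl | rfl
    · exact hD τ hτ hodd
    · exact hG τ hτ hodd
  have he : Even m := by
    rcases hm with rfl | rfl
    · exact hodd.add_odd odd_one
    · exact Nat.Odd.sub_odd hodd odd_one
  exact IK2020_prop_5_3_2_holds m h4 he hAT

end Literature.Computability.AlgebraicComplexity
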